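import Literature.NumberTheory.EllipticCurves.ModularSymbolsControlInjective
import HarnessLib

/-!
# Greenberg's lifting iteration for ordinary modular symbols (measure coefficients)

The inductive step of M. Greenberg's proof of Stevens' control theorem (Israel J. Math. 161 (2007),
Prop. 12 and the proof of Thm. 9), run for the integral coefficient system `𝔻⁰_k` of measures on `ℤ_p`
(`distCoeffInt`, `p ∣ N`) and Greenberg's filtration `F^n 𝔻⁰_k` (`filGInt`):

* **additive lifts always exist** (`exists_additive_lift`): an additive function of pairs of cusps is a
  difference of a potential, `φ(x, y) = G(y) − G(x)` (`modSym_eq_potential`), and potentials lift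
  through surjections — this replaces the use of a presentation of `Δ₀`;
* **the step** (`step_congr`, `step_slash`, `step_hecke`): if `Φ` is additive, `𝔻⁰`-valued, `Γ₀(N)`-invariant
  modulo `F^n` and a `U_p`-eigenfunction with unit eigenvalue `u` modulo `F^n`, then `Φ' = u⁻¹ U_p Φ` is
  congruent to `Φ` modulo `F^n` and satisfies both conditions modulo `F^{n+1}` — the key identity is
  `(U_p Φ)|γ − U_p Φ = Σᵢ (Φ|γᵢ' − Φ)|β_{σ(i)}` (`slash_hecke_sub_hecke`) together with the contraction of
  the `β`'s (`distρInt_heckeRep_mem_filGInt_succ`, `hecke_val_mem_filGInt_succ`);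
* **the iteration** (`liftSeq`, `liftSeq_spec`): starting from an additive `Φ₀` whose defects lie in
  `F⁰` (e.g. any additive lift of an exact `U_p`-eigensymbol with values in `Symᵏ`, `liftSeq_start`),
  `Φ_{n+1} = u⁻¹ U_p Φ_n` is `Γ₀(N)`-invariant and `U_p`-eigen modulo `F^n`, and `Φ_{n+1} ≡ Φ_n (mod F^n)`.

The reductions `Φ_n mod F^n` are thus genuine compatible eigensymbols in `Symb(𝔻⁰/F^n)`; their limit
in the `F`-completion is the lift (next brick).  Brick B3e-S1/S2 of the bottom-up plan recorded with the
named fact `greenbergStevens_kitagawa_twoVariable_interpolation_allBranches`.  Everything is proved; no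
named facts.

## References

* M. Greenberg, Israel J. Math. 161 (2007), §4, Prop. 12, proof of Thm. 9. [Greenberg2007Lifting]
-/

noncomputable section

open scoped MatrixGroups
open Matrix CongruenceSubgroup

namespace Literature.NumberTheory.EllipticCurves

open ModularForms ModularForms.HidaCohomology

/-! ### Potentials and additive lifts -/

section Potential

variable {R V W : Type*} [CommRing R] [AddCommGroup V] [Module R V] [AddCommGroup W] [Module R W]

/-- **An additive function of pairs of cusps is the coboundary of its potential `G = φ(∞, ·)`.** [folklore] -/
theorem modSym_eq_potential {φ : P1Q → P1Q → V} (hφ : φ ∈ modSym R V) (x y : P1Q) :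
    φ x y = φ P1Q.infty y - φ P1Q.infty x := by
  rw [← (mem_modSym_iff (R := R)).mp hφ P1Q.infty x y, add_sub_cancel_left]

/-- Coboundaries of potentials are additive. [folklore] -/
theorem potential_mem_modSym (G : P1Q → V) : (fun x y => G y - G x) ∈ modSym R V :=
  (mem_modSym_iff (R := R)).mpr fun x y z => by abel

/-- **Additive lifts exist**: an additive `W`-valued `φ` whose values lie in the range of a linear
`π : V → W` is `π ∘ Φ` for an additive `V`-valued `Φ`. [folklore] -/
theorem exists_additive_lift (π : V →ₗ[R] W) {φ : P1Q → P1Q → W} (hφ : φ ∈ modSym R W)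
    (hrange : ∀ y, φ P1Q.infty y ∈ LinearMap.range π) :
    ∃ Φ ∈ modSym R V, ∀ x y, π (Φ x y) = φ x y := by
  choose G hG using hrange
  refine ⟨fun x y => G y - G x, potential_mem_modSym G, fun x y => ?_⟩
  rw [map_sub, hG, hG, ← modSym_eq_potential hφ]

end Potential

/-! ### The commutation of `U_p` with `Γ₀(N)` on functions of pairs of cusps -/

section Commute

variable {S : Set (Matrix (Fin 2) (Fin 2) ℤ)} {R V : Type*} [CommRing R] [AddCommGroup V] [Module R V]
  (A : CoeffActionOn S R V) {N p : ℕ} [NeZero p] (hp : p.Prime)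

/-- **`(U_p Φ)|γ = Σᵢ (Φ|γᵢ')|β_{σ(i)}`** for `γ ∈ Γ₀(N)` (from `βᵢ γ = γᵢ' β_{σ(i)}`), for ANY function `Φ`.
[cite: Shimura1971, §3.4] -/
theorem slash_hecke_eq_sum (hΓ : ∀ γ : Gamma0 N, gmat γ ∈ S) (hβ : ∀ i : HeckeIdx N p, heckeRep p i.1 ∈ S)
    (γ : Gamma0 N) (Φ : P1Q → P1Q → V) :
    A.slash (gmat γ) (A.hecke N p Φ) =
      ∑ i : HeckeIdx N p, A.slash (heckeRep p (heckePerm hp γ i).1) (A.slash (gmat (heckePermElt hp γ i)) Φ) := by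
  have hdetβ : ∀ i : HeckeIdx N p, (heckeRep p i.1).det ≠ 0 := fun i => by
    rw [det_heckeRep]; exact_mod_cast hp.ne_zero
  have hdetγ : ∀ δ : Gamma0 N, (gmat δ).det ≠ 0 := fun δ => by
    rw [gmat, Matrix.SpecialLinearGroup.det_coe]; exact one_ne_zero
  rw [A.hecke_apply, map_sum]
  refine Finset.sum_congr rfl fun i _ => ?_
  have e := gmat_heckePermElt_mul hp γ i
  rw [← LinearMap.comp_apply (f := A.slash (gmat γ)), ← A.slash_mul (hβ i) (hΓ γ) (hdetβ i) (hdetγ γ), ← e,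
    A.slash_mul (hΓ _) (hβ _) (hdetγ _) (hdetβ _), LinearMap.comp_apply]

/-- **`(U_p Φ)|γ − U_p Φ = Σᵢ (Φ|γᵢ' − Φ)|β_{σ(i)}`.** [cite: Greenberg2007Lifting, Prop. 12] -/
theorem slash_hecke_sub_hecke (hΓ : ∀ γ : Gamma0 N, gmat γ ∈ S) (hβ : ∀ i : HeckeIdx N p, heckeRep p i.1 ∈ S)
    (γ : Gamma0 N) (Φ : P1Q → P1Q → V) :
    A.slash (gmat γ) (A.hecke N p Φ) - A.hecke N p Φ =
      ∑ i : HeckeIdx N p, A.slash (heckeRep p (heckePerm hp γ i).1) (A.slash (gmat (heckePermElt hp γ i)) Φ - Φ) := by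
  rw [slash_hecke_eq_sum A hp hΓ hβ, A.hecke_apply]
  -- reindex the second sum by `σ_γ`
  rw [← (heckePermEquiv hp γ).sum_comp (fun j => A.slash (heckeRep p j.1) Φ), ← Finset.sum_sub_distrib]
  refine Finset.sum_congr rfl fun i _ => ?_
  rw [heckePermEquiv_apply, map_sub]

end Commute

/-! ### Greenberg's step -/

section Step

variable {p : ℕ} [Fact p.Prime] [NeZero p] {k N : ℕ} (hpN : p ∣ N) (u : ℤ_[p]ˣ)

omit [NeZero p] in
/-- Values of `Φ|β` lie in `F^{n+1}` when those of `Φ` lie in `F^n`, for the Hecke matrices `β`. [folklore] -/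
theorem slash_heckeRep_val_mem_filGInt_succ (i : HeckeIdx N p) (n : ℕ) (Ψ : P1Q → P1Q → DInt p)
    (hΨ : ∀ x y, Ψ x y ∈ filGInt p k n) (x y : P1Q) :
    (distCoeffInt p k N hpN).slash (heckeRep p i.1) Ψ x y ∈ filGInt p k (n + 1) := by
  obtain ⟨j, hj⟩ := heckeIdx_eq_some hpN i
  rw [CoeffActionOn.slash_apply, distCoeffInt_ρ, hj]
  exact distρInt_heckeRep_mem_filGInt_succ k hpN j n _ (hΨ _ _)

/-- **The step, congruence**: `u⁻¹ U_p Φ ≡ Φ (mod F^n)` if `U_p Φ ≡ u Φ (mod F^n)`. [cite: Greenberg2007Lifting, Prop. 12] -/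
theorem step_congr (n : ℕ) (Φ : P1Q → P1Q → DInt p)
    (hU : ∀ x y, ((distCoeffInt p k N hpN).hecke N p Φ - (u : ℤ_[p]) • Φ) x y ∈ filGInt p k n) (x y : P1Q) :
    (((u⁻¹ : ℤ_[p]ˣ) : ℤ_[p]) • (distCoeffInt p k N hpN).hecke N p Φ - Φ) x y ∈ filGInt p k n := by
  have h : (((u⁻¹ : ℤ_[p]ˣ) : ℤ_[p]) • (distCoeffInt p k N hpN).hecke N p Φ - Φ) x y =
      ((u⁻¹ : ℤ_[p]ˣ) : ℤ_[p]) • (((distCoeffInt p k N hpN).hecke N p Φ - (u : ℤ_[p]) • Φ) x y) := by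
    simp only [Pi.sub_apply, Pi.smul_apply, smul_sub, smul_smul, Units.inv_mul, one_smul]
  rw [h]
  exact Submodule.smul_mem _ _ (hU x y)

/-- **The step, invariance**: if `Φ|γ ≡ Φ (mod F^n)` for all `γ ∈ Γ₀(N)` then `(u⁻¹U_pΦ)|γ ≡ u⁻¹U_pΦ (mod F^{n+1})`.
[cite: Greenberg2007Lifting, Prop. 12] -/
theorem step_slash (n : ℕ) (Φ : P1Q → P1Q → DInt p)
    (hΓ : ∀ γ : Gamma0 N, ∀ x y, ((distCoeffInt p k N hpN).slash (gmat γ) Φ - Φ) x y ∈ filGInt p k n)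
    (γ : Gamma0 N) (x y : P1Q) :
    ((distCoeffInt p k N hpN).slash (gmat γ) (((u⁻¹ : ℤ_[p]ˣ) : ℤ_[p]) • (distCoeffInt p k N hpN).hecke N p Φ) -
        ((u⁻¹ : ℤ_[p]ˣ) : ℤ_[p]) • (distCoeffInt p k N hpN).hecke N p Φ) x y ∈ filGInt p k (n + 1) := by
  have key : ((distCoeffInt p k N hpN).slash (gmat γ) (((u⁻¹ : ℤ_[p]ˣ) : ℤ_[p]) • (distCoeffInt p k N hpN).hecke N p Φ) -
      ((u⁻¹ : ℤ_[p]ˣ) : ℤ_[p]) • (distCoeffInt p k N hpN).hecke N p Φ) x y =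
      ((u⁻¹ : ℤ_[p]ˣ) : ℤ_[p]) • (((distCoeffInt p k N hpN).slash (gmat γ) ((distCoeffInt p k N hpN).hecke N p Φ) -
        (distCoeffInt p k N hpN).hecke N p Φ) x y) := by
    simp only [map_smul, Pi.sub_apply, Pi.smul_apply, smul_sub]
  rw [key]
  refine Submodule.smul_mem _ _ ?_
  rw [slash_hecke_sub_hecke (distCoeffInt p k N hpN) Fact.out (gamma0_mem_sigma0Set N)
    (fun i => heckeRep_mem_sigma0Set Fact.out i) γ Φ, Finset.sum_apply, Finset.sum_apply]
  refine Submodule.sum_mem _ fun i _ => ?_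
  exact slash_heckeRep_val_mem_filGInt_succ hpN (heckePerm Fact.out γ i) n _ (hΓ (heckePermElt Fact.out γ i)) x y

/-- **The step, eigen-property**: if `U_pΦ ≡ uΦ (mod F^n)` then `U_p(u⁻¹U_pΦ) ≡ u(u⁻¹U_pΦ) (mod F^{n+1})`.
[cite: Greenberg2007Lifting, Prop. 12] -/
theorem step_hecke (n : ℕ) (Φ : P1Q → P1Q → DInt p)
    (hU : ∀ x y, ((distCoeffInt p k N hpN).hecke N p Φ - (u : ℤ_[p]) • Φ) x y ∈ filGInt p k n) (x y : P1Q) :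
    ((distCoeffInt p k N hpN).hecke N p (((u⁻¹ : ℤ_[p]ˣ) : ℤ_[p]) • (distCoeffInt p k N hpN).hecke N p Φ) -
        (u : ℤ_[p]) • (((u⁻¹ : ℤ_[p]ˣ) : ℤ_[p]) • (distCoeffInt p k N hpN).hecke N p Φ)) x y ∈ filGInt p k (n + 1) := by
  have h : (distCoeffInt p k N hpN).hecke N p (((u⁻¹ : ℤ_[p]ˣ) : ℤ_[p]) • (distCoeffInt p k N hpN).hecke N p Φ) -
      (u : ℤ_[p]) • (((u⁻¹ : ℤ_[p]ˣ) : ℤ_[p]) • (distCoeffInt p k N hpN).hecke N p Φ) =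
      ((u⁻¹ : ℤ_[p]ˣ) : ℤ_[p]) • (distCoeffInt p k N hpN).hecke N p ((distCoeffInt p k N hpN).hecke N p Φ - (u : ℤ_[p]) • Φ) := by
    rw [map_smul, smul_smul, Units.mul_inv, one_smul, map_sub, map_smul, smul_sub, smul_smul, Units.inv_mul, one_smul]
  rw [h, Pi.smul_apply, Pi.smul_apply]
  exact Submodule.smul_mem _ _ (hecke_val_mem_filGInt_succ k N hpN n _ hU x y)

end Step

/-! ### The iteration -/

section Iterate

variable {p : ℕ} [Fact p.Prime] [NeZero p] (k : ℕ) {N : ℕ} (hpN : p ∣ N) (u : ℤ_[p]ˣ)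

/-- **Greenberg's sequence** `Φ₀, Φ_{n+1} = u⁻¹ U_p Φ_n`. [cite: Greenberg2007Lifting, §4] -/
def liftSeq (Φ₀ : P1Q → P1Q → DInt p) : ℕ → (P1Q → P1Q → DInt p)
  | 0 => Φ₀
  | n + 1 => ((u⁻¹ : ℤ_[p]ˣ) : ℤ_[p]) • (distCoeffInt p k N hpN).hecke N p (liftSeq Φ₀ n)

/-- The recursion. [folklore] -/
theorem liftSeq_succ (Φ₀ : P1Q → P1Q → DInt p) (n : ℕ) :
    liftSeq k hpN u Φ₀ (n + 1) = ((u⁻¹ : ℤ_[p]ˣ) : ℤ_[p]) • (distCoeffInt p k N hpN).hecke N p (liftSeq k hpN u Φ₀ n) := rfl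

/-- **The invariants of the iteration**: every `Φ_n` is additive, `Γ₀(N)`-invariant modulo `F^n`, a
`U_p`-eigenfunction with eigenvalue `u` modulo `F^n`, and `Φ_{n+1} ≡ Φ_n (mod F^n)`.
[cite: Greenberg2007Lifting, Prop. 12] -/
theorem liftSeq_spec (Φ₀ : P1Q → P1Q → DInt p) (h0 : Φ₀ ∈ modSym ℤ_[p] (DInt p))
    (hΓ0 : ∀ γ : Gamma0 N, ∀ x y, ((distCoeffInt p k N hpN).slash (gmat γ) Φ₀ - Φ₀) x y ∈ filGInt p k 0)
    (hU0 : ∀ x y, ((distCoeffInt p k N hpN).hecke N p Φ₀ - (u : ℤ_[p]) • Φ₀) x y ∈ filGInt p k 0) (n : ℕ) :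
    liftSeq k hpN u Φ₀ n ∈ modSym ℤ_[p] (DInt p) ∧
      (∀ γ : Gamma0 N, ∀ x y, ((distCoeffInt p k N hpN).slash (gmat γ) (liftSeq k hpN u Φ₀ n) - liftSeq k hpN u Φ₀ n) x y ∈ filGInt p k n) ∧
      (∀ x y, ((distCoeffInt p k N hpN).hecke N p (liftSeq k hpN u Φ₀ n) - (u : ℤ_[p]) • liftSeq k hpN u Φ₀ n) x y ∈ filGInt p k n) ∧
      ∀ x y, (liftSeq k hpN u Φ₀ (n + 1) - liftSeq k hpN u Φ₀ n) x y ∈ filGInt p k n := by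
  induction n with
  | zero => exact ⟨h0, hΓ0, hU0, fun x y => step_congr hpN u 0 Φ₀ hU0 x y⟩
  | succ n ih =>
    obtain ⟨hadd, hΓ, hU, -⟩ := ih
    have hadd' : liftSeq k hpN u Φ₀ (n + 1) ∈ modSym ℤ_[p] (DInt p) := by
      rw [liftSeq_succ]
      exact Submodule.smul_mem _ _ ((distCoeffInt p k N hpN).hecke_mem_modSym hadd)
    have hU' : ∀ x y, ((distCoeffInt p k N hpN).hecke N p (liftSeq k hpN u Φ₀ (n + 1)) -
        (u : ℤ_[p]) • liftSeq k hpN u Φ₀ (n + 1)) x y ∈ filGInt p k (n + 1) := fun x y => by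
      rw [liftSeq_succ]; exact step_hecke hpN u n _ hU x y
    refine ⟨hadd', fun γ x y => ?_, hU', fun x y => step_congr hpN u (n + 1) _ hU' x y⟩
    rw [liftSeq_succ]
    exact step_slash hpN u n _ hΓ γ x y

/-- Consequently `Φ_n ≡ Φ_m (mod F^m)` for `m ≤ n`. [folklore] -/
theorem liftSeq_congr (Φ₀ : P1Q → P1Q → DInt p) (h0 : Φ₀ ∈ modSym ℤ_[p] (DInt p))
    (hΓ0 : ∀ γ : Gamma0 N, ∀ x y, ((distCoeffInt p k N hpN).slash (gmat γ) Φ₀ - Φ₀) x y ∈ filGInt p k 0)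
    (hU0 : ∀ x y, ((distCoeffInt p k N hpN).hecke N p Φ₀ - (u : ℤ_[p]) • Φ₀) x y ∈ filGInt p k 0)
    {m n : ℕ} (hmn : m ≤ n) (x y : P1Q) :
    (liftSeq k hpN u Φ₀ n - liftSeq k hpN u Φ₀ m) x y ∈ filGInt p k m := by
  induction hmn with
  | refl => rw [sub_self]; exact zero_mem _
  | @step n hmn ih =>
    have h := (liftSeq_spec k hpN u Φ₀ h0 hΓ0 hU0 n).2.2.2 x y
    have h' : (liftSeq k hpN u Φ₀ (n + 1) - liftSeq k hpN u Φ₀ n) x y ∈ filGInt p k m :=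
      (filG_antitone k hmn) h
    have : (liftSeq k hpN u Φ₀ (n + 1) - liftSeq k hpN u Φ₀ m) x y =
        (liftSeq k hpN u Φ₀ (n + 1) - liftSeq k hpN u Φ₀ n) x y + (liftSeq k hpN u Φ₀ n - liftSeq k hpN u Φ₀ m) x y := by
      simp only [Pi.sub_apply]; abel
    rw [this]
    exact add_mem h' ih

omit [NeZero p] hpN u in
/-- **Starting the iteration**: if the defects of an additive `Φ₀` are invisible to the moments of order
`≤ k` (e.g. `Φ₀` lifts an exact `Symᵏ`-valued `U_p`-eigensymbol), they lie in `F⁰`. [folklore] -/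
theorem liftSeq_start {Ψ : P1Q → P1Q → DInt p} (hΨ : ∀ (x y : P1Q) (i : ℕ), i ≤ k → moment (Ψ x y).1 i = 0) (x y : P1Q) :
    Ψ x y ∈ filGInt p k 0 :=
  mem_filG_zero_of_moments (Ψ x y).2 (hΨ x y)

end Iterate

end Literature.NumberTheory.EllipticCurves

end
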